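import Summits.QuantumFields.YangMills.Theorems.BalabanUVNodesN15PerCubeGreenNodeObjectsGradient
import HarnessLib

/-!
# N15 = NE2, road (c) — PROGRAMME (PC), (PC-E-K-N): THE NODE OBJECTS OF THE ADJOINT ENTRY — ENTRY 2 OF (3.42) IN A DIRECTION `ν` FOR THE NAMED SCALAR COVARIANT GREEN's FUNCTION
# FAMILY ON THE PRINTED PER-CUBE CLASS: `pcEntry2 ν` = the two-grid η-defect through `τ_{Ad∘U′}` of `(Δ_{R_U′} + a′Q′_TᵀQ′_T)⁻¹ ∘ D*_{U′,ν}` against `(Δ_{R_Ū} + aQ′_TᵀQ′_T)⁻¹ ∘ D*_{Ū,ν}`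
# (n15-c∕435's operator VERBATIM), the operator quadruple `pcOps₂ μ₀ ν` with ALL FOUR ENTRIES CONSTRUCTED and its kernel family `pcFamily₂` (dag-n15-c g38, n15-c∕436a)

Cell `pub-ymgap`, seat `pub-ymgap-dag-n15-c` (generation g38; R134 (a) seat, strategy s1 «first missing estimate»; HUMAN RULING D-0062; chair R424 venue).
`bears_on: R4∕N15 · K3⁸ SpineGivenEndpointR13SepCoPHV (stmt-QuantumFields-27366)`; filed `--kind definition --supports stmt-QuantumFields-27366 --as helper` — COUNT-NEUTRAL
(definitions: reviewed ∕ async-audit lane).  3 `def` + 7 `rfl` lemmas; 0 `sorry`, 0 `instance`.  Imports BY NAME n15-c∕421 `…PerCubeGreenNodeObjectsGradient` (`pcEntry1`, `pcOps₁`,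
`pcFamily₁`; through it n15-c∕397 `PcIdx`, `pcGeo`, `pcBgF`, `pcInstance`, `pcEntry0`, `pcEntry3`, n15-c∕388 `scGreenOp(′)`, the (PC) site carriers, `ctauS`, `kingSec`, `mprod`, n15-b
`opGeo`∕`opFamily`, `MatrixSpecies.covD`, `cvT`).  Nothing in the tree is modified, no landed name re-declared; generator HOME `tools/g38/build_436.py` (the entry operator is CUT VERBATIM from
n15-c∕432∕435's conclusion, indices `m k r ↦ i.mv i.kk i.r`).

WHAT (objects for n15-c∕436's `NE2PlusOperator` readout with ALL FOUR entries of [B9] (3.42) constructed):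
* `pcEntry2 … i ν U′` — ENTRY 2 OF [B9] (3.42) (`G′∇*_U`, the ADJOINT arrangement) IN THE DIRECTION `ν`, at two spacings: `𝔇_{τ_{Ad∘U′}}(scGreenOp′ … U′ ∘ D*_{U′,ν}, scGreenOp … Ū ∘ D*_{Ū,ν})`
  — THE named inverses (n15-c∕388) at King's masses followed by n15-c∕284's adjoint covariant derivative `covD η (y ↦ (Ad U_ν(y − e_ν))ᵀ) (· − e_ν)` of the raw fields (`cvT e U`), `Ū` = the
  straight fine holonomies of `U′` along King's block lines; one operator per direction, as for entry 1;
* `pcOps₂ … i μ₀ ν` := `pcOps₁ … i μ₀ (fun _ U′ => pcEntry2 … i ν U′)` — THE FOUR ENTRY OPERATORS, entries 0 (`pcEntry0`), 1 (`pcEntry1 μ₀`), 2 (`pcEntry2 ν`), 3 (`pcEntry3`), NO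
  consumer slot left; unfolding lemmas `pcOps₂_zero∕one∕two∕three`;
* `pcFamily₂ … i μ₀ ν` := `pcFamily₁ … i μ₀ (fun _ U′ => pcEntry2 … i ν U′)` — n15-b `opFamily` of `pcOps₂` on the coloured (PC) site carriers; `pcFamily₂_eq` (rfl), `pcFamily₂_e` (unfolding).

HONEST FRAMING ∕ LIMITS.  Plumbing only (definitions + `rfl` lemmas); MODEL carriers ∕ class ∕ pairing ∕ operators as in the (PC) chain (King's doubled-torus cover model, one cube scale
`ξ = 1`, the (3.35) constant tied to the size parameter `M = L^m` of the cover's cubes); nothing of [B9]∕[B11] asserted; NE2⁺ NOT PRINTED, NOT proved; N15 of record untouched (DISCHARGED AS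
CONSUMED, p687738); K3⁸ OPEN; counts of record UNMOVED (typed 28∕28 · discharged 8∕27); one finite 𝕋⁴ at fixed ε per index — NOT infinite volume, NOT OS on ℝ⁴, NOT a mass gap, NOT Clay.
Restate-immune (no Theses import).
-/

set_option autoImplicit false

noncomputable section

open scoped BigOperators Matrix Matrix.Norms.L2Operator

namespace Summit.QuantumFields.YangMills.BalabanUVNodes.N15.Gluing

open Literature.MathematicalPhysics.QuantumFieldTheory.Balaban1983to89
open Literature.MathematicalPhysics.QuantumFieldTheory.Balaban1983to89.B5Prop11Plancherel (Tor fine unitVec)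
open Literature.MathematicalPhysics.QuantumFieldTheory.Balaban1983to89.T4EtaRateDefect (idef)
open Literature.MathematicalPhysics.QuantumFieldTheory.Balaban1983to89.B11SectG (BlockNorm)
open Literature.MathematicalPhysics.QuantumFieldTheory.Balaban1983to89.B6UnitTorusCarrier (unitTorusGeo)
open Literature.MathematicalPhysics.QuantumFieldTheory.King1986 (aK)
open Literature.MathematicalPhysics.QuantumFieldTheory.King1986.Torus (tdistT)
open Summit.QuantumFields.YangMills.BalabanUVNodes.N15.VectorPiece (kingPr unitTorusGeoS)
open Summit.QuantumFields.YangMills.BalabanUVNodes.N15.MatrixSpecies (coordMat liftMap liftBlk covD)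
open Summit.QuantumFields.YangMills.BalabanUVNodes.N15.CurvedSpecies (gaugePair)
open Summit.QuantumFields.YangMills.BalabanUVNodes.N15.CovAvg (mprod kingSec ctauS)
open Summit.QuantumFields.YangMills.BalabanUVNodes.N15.OperatorReadout (opGeo opFamily)

variable {d : ℕ}

section Family

variable (d) {L : ℕ} [NeZero L] (mm ι : Type) [Fintype mm] [DecidableEq mm] [Fintype ι] [DecidableEq ι] (a₀ : ℝ) (e : Matrix mm mm ℂ ≃L[ℝ] (ι → ℝ)) (c₄r β₀ : ℝ)

/-- ★ **ENTRY 2 OF THE NAMED FAMILY IN THE DIRECTION `ν`** (`G′∇*_U` of [B9] (3.42), one component, the ADJOINT arrangement): the η-defect through the covariant transport `τ_{Ad∘U′}`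
between `scGreenOp′ … U′ ∘ D*_{U′,ν}` (THE fine named Green's function `(Δ_{R_U′} + a′Q′_TᵀQ′_T)⁻¹` at King's mass, followed by n15-c∕284's adjoint covariant derivative of the raw field
`U′_ν`) and `scGreenOp … Ū ∘ D*_{Ū,ν}` at the straight holonomies `Ū` of `U′` — n15-c∕432∕435's operator VERBATIM.
[cite: Balaban1985BackgroundPropagators, (3.42) p.397 (third entry `G′∇*_U`: shape), (3.24)–(3.25) p.394, Thm 3.14 pp.426–427 (difference template); Balaban1984PropagatorsII, (2.93) p.239 (shape)] -/
def pcEntry2 (hL : Odd L ∧ 1 < L) (i : PcIdx d L) (ν : Fin (d + 1)) (U' : Fin (d + 1) → ScX' d L i.mv i.kk i.r hL → (Matrix mm mm ℂ)ˣ) :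
    (ScX d L i.mv i.kk hL × ι → ℝ) →ₗ[ℝ] (ScX' d L i.mv i.kk i.r hL × ι → ℝ) :=
  idef (ctauS (cvM d L i.mv i.kk hL) L i.kk i.r (fun μ x' => coordMat e (ContinuousLinearMap.mulLeftRight ℝ (Matrix mm mm ℂ) ((U' μ x' : Matrix mm mm ℂ)) ((U' μ x' : Matrix mm mm ℂ))ᴴ))) (ctauS (cvM d L i.mv i.kk hL) L i.kk i.r (fun μ x' => coordMat e (ContinuousLinearMap.mulLeftRight ℝ (Matrix mm mm ℂ) ((U' μ x' : Matrix mm mm ℂ)) ((U' μ x' : Matrix mm mm ℂ))ᴴ)))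
    ((scGreenOp' d L i.mv i.kk i.r hL (aK a₀ (L : ℝ) (i.r + i.kk) * (((L ^ i.r * L ^ i.kk : ℕ) : ℝ)) ^ (d + 1)) ((((L ^ i.r * L ^ i.kk : ℕ) : ℝ))⁻¹) ι e (fun μ z => (U' μ z : Matrix mm mm ℂ))) ∘ₗ (covD ((((L ^ i.r * L ^ i.kk : ℕ) : ℝ))⁻¹) (fun y => ((cvT e (fun μ z => (U' μ z : Matrix mm mm ℂ))) ν (((scShift' d L i.mv i.kk i.r hL) ν).symm y))ᵀ) ⇑(((scShift' d L i.mv i.kk i.r hL) ν).symm)))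
    ((scGreenOp d L i.mv i.kk hL (aK a₀ (L : ℝ) i.kk * (((L ^ i.kk : ℕ) : ℝ)) ^ (d + 1)) ((((L ^ i.kk : ℕ) : ℝ))⁻¹) ι e (fun μ y => mprod (fun t => (U' μ (kingSec (cvM d L i.mv i.kk hL) L i.kk i.r y + t • unitVec (fine (L ^ i.r * L ^ i.kk) (cvM d L i.mv i.kk hL)) μ) : Matrix mm mm ℂ)) (L ^ i.r))) ∘ₗ (covD ((((L ^ i.kk : ℕ) : ℝ))⁻¹) (fun y => ((cvT e (fun μ y => mprod (fun t => (U' μ (kingSec (cvM d L i.mv i.kk hL) L i.kk i.r y + t • unitVec (fine (L ^ i.r * L ^ i.kk) (cvM d L i.mv i.kk hL)) μ) : Matrix mm mm ℂ)) (L ^ i.r))) ν (((scShift d L i.mv i.kk hL) ν).symm y))ᵀ) ⇑(((scShift d L i.mv i.kk hL) ν).symm)))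

/-- THE FOUR ENTRY OPERATORS WITH ALL ENTRIES CONSTRUCTED: `pcOps₁ μ₀` with its consumer slot (entry 2) filled by `pcEntry2 ν`. [cite: Balaban1985BackgroundPropagators, (3.42) p.397 (the four entries: shape)] -/
def pcOps₂ (hL : Odd L ∧ 1 < L) (i : PcIdx d L) (μ₀ ν : Fin (d + 1)) :
    Fin 4 → (Fin (d + 1) → ScX' d L i.mv i.kk i.r hL → (Matrix mm mm ℂ)ˣ) → ((ScX d L i.mv i.kk hL × ι → ℝ) →ₗ[ℝ] (ScX' d L i.mv i.kk i.r hL × ι → ℝ)) :=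
  pcOps₁ d mm ι a₀ e hL i μ₀ (fun _ U' => pcEntry2 d mm ι a₀ e hL i ν U')

/-- Unfolding: entry 0. [folklore] -/
@[simp] theorem pcOps₂_zero (hL : Odd L ∧ 1 < L) (i : PcIdx d L) (μ₀ ν : Fin (d + 1)) (U' : Fin (d + 1) → ScX' d L i.mv i.kk i.r hL → (Matrix mm mm ℂ)ˣ) :
    pcOps₂ d mm ι a₀ e hL i μ₀ ν 0 U' = pcEntry0 d mm ι a₀ e hL i U' := rfl

/-- Unfolding: entry 1 (the gradient entry in the direction `μ₀`). [folklore] -/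
@[simp] theorem pcOps₂_one (hL : Odd L ∧ 1 < L) (i : PcIdx d L) (μ₀ ν : Fin (d + 1)) (U' : Fin (d + 1) → ScX' d L i.mv i.kk i.r hL → (Matrix mm mm ℂ)ˣ) :
    pcOps₂ d mm ι a₀ e hL i μ₀ ν 1 U' = pcEntry1 d mm ι a₀ e hL i μ₀ U' := rfl

/-- Unfolding: entry 2 is THE CONSTRUCTED adjoint entry in the direction `ν`. [folklore] -/
@[simp] theorem pcOps₂_two (hL : Odd L ∧ 1 < L) (i : PcIdx d L) (μ₀ ν : Fin (d + 1)) (U' : Fin (d + 1) → ScX' d L i.mv i.kk i.r hL → (Matrix mm mm ℂ)ˣ) :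
    pcOps₂ d mm ι a₀ e hL i μ₀ ν 2 U' = pcEntry2 d mm ι a₀ e hL i ν U' := rfl

/-- Unfolding: entry 3. [folklore] -/
@[simp] theorem pcOps₂_three (hL : Odd L ∧ 1 < L) (i : PcIdx d L) (μ₀ ν : Fin (d + 1)) (U' : Fin (d + 1) → ScX' d L i.mv i.kk i.r hL → (Matrix mm mm ℂ)ˣ) :
    pcOps₂ d mm ι a₀ e hL i μ₀ ν 3 U' = pcEntry3 d mm ι a₀ e hL i U' := rfl

/-- THE KERNEL FAMILY with all four entries constructed: `pcFamily₁ μ₀` at the quadruple whose entry 2 is `pcEntry2 ν`. [cite: Balaban1985BackgroundPropagators, (3.42) p.397 (shape)] -/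
def pcFamily₂ (hL : Odd L ∧ 1 < L) (i : PcIdx d L) (μ₀ ν : Fin (d + 1)) : B9.KernelFamily (pcInstance d mm ι c₄r β₀ hL i).gc (pcInstance d mm ι c₄r β₀ hL i).Bf :=
  pcFamily₁ d mm ι a₀ e c₄r β₀ hL i μ₀ (fun _ U' => pcEntry2 d mm ι a₀ e hL i ν U')

/-- `pcFamily₂` is `pcFamily₁` at the filled quadruple (so every fact about `pcFamily₁`∕`pcFamily` transfers). [folklore] -/
theorem pcFamily₂_eq (hL : Odd L ∧ 1 < L) (i : PcIdx d L) (μ₀ ν : Fin (d + 1)) :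
    pcFamily₂ d mm ι a₀ e c₄r β₀ hL i μ₀ ν = pcFamily₁ d mm ι a₀ e c₄r β₀ hL i μ₀ (fun _ U' => pcEntry2 d mm ι a₀ e hL i ν U') := rfl

/-- Unfolding of the entries: the sharp fine-cube sup of the entry operator applied to the test function. [folklore] -/
theorem pcFamily₂_e (hL : Odd L ∧ 1 < L) (i : PcIdx d L) (μ₀ ν : Fin (d + 1)) (n : Fin 4) (U' : Fin (d + 1) → ScX' d L i.mv i.kk i.r hL → (Matrix mm mm ℂ)ˣ)
    (lam : ScX d L i.mv i.kk hL × ι → ℝ) (y : (pcGeo d hL i).Site) :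
    (pcFamily₂ d mm ι a₀ e c₄r β₀ hL i μ₀ ν).e n U' lam y =
      (BlockNorm.ofBlocks (pcGeo d hL i) (liftBlk (scBlk d L i.mv i.kk hL ∘ kingPr L i.kk i.r (cvM d L i.mv i.kk hL)) ι)).loc y (pcOps₂ d mm ι a₀ e hL i μ₀ ν n U' lam) := rfl

end Family

end Summit.QuantumFields.YangMills.BalabanUVNodes.N15.Gluing

end
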